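import Literature.AlgebraicGeometry.FundamentalGroup.HypersurfaceComplementMeridiansConj
import Mathlib.RingTheory.Nullstellensatz
import Mathlib.Algebra.MvPolynomial.NoZeroDivisors
import Mathlib.Algebra.MvPolynomial.Nilpotent
import HarnessLib

/-!
# An irreducible affine hypersurface has a smooth point, hence a meridian (Zariski; Deligne, Weil I (5.2))

Family `hodge`, layer `Literature/AlgebraicGeometry/FundamentalGroup`; theorems only (no definition, no named
fact). Companion of `HypersurfaceComplementMeridians{,Conj,Generate}`: the Zariski–van Kampen theorems there
(`affineHypersurfaceComplement_meridians_normalClosure_eq_top_holds`, `…_meridian_isConj_holds`) are quantified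
over GIVEN meridians `μ : Meridian h s j`; a consumer with one irreducible component `h = ![g]` needs one to
exist. Deligne (Weil I (5.2)): "le lieu lisse de `X̌`" — the smooth locus of an irreducible (reduced)
hypersurface — is non-empty, and "Ces lacets [around its points] engendrent le groupe fondamental".

* `exists_eval_eq_zero_and_eval_pderiv_ne_zero_of_irreducible` — **an irreducible `g ∈ ℂ[x_i]` (finitely
  many variables) has a zero at which some `∂g/∂x_k` does not vanish.** Proof: `g` is not constant, so some
  `∂_k g ≠ 0`; `deg_{x_k} ∂_k g < deg_{x_k} g`, so `g ∤ ∂_k g`; by the Nullstellensatz (`(g)` is prime,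
  `I(V(g)) = (g)`) `∂_k g` does not vanish identically on `V(g)`.
* `goodLocus_nonempty_of_irreducible`, **`nonempty_meridian_of_irreducible`** — hence the good locus of
  `V(g)` is non-empty and, `ℂ^ι ∖ V(g)` being path connected, there is a meridian of `V(g)` based at every
  point of the complement (`MeridianConj.exists_meridian_of_mem_goodLocus`).

Written by the prover seat `hodge-nonav-prover-Bx` (g8) for the route `CyclicUnitaryPowers` of the Hodge summit
(the one meridian of the discriminant of the cyclic family that Zariski–van Kampen normally generates from).

## References

* [Deligne1974] P. Deligne, La conjecture de Weil. I, Publ. Math. IHÉS 43 (1974), (5.2) and proof of (5.4)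
  (pp. 290–291: the smooth locus of the irreducible dual variety, lassos around it).
* [Shimada2010ZvK] I. Shimada, Lectures on Zariski–van Kampen theorem, arXiv:0906.1074, §3 (transversal discs
  at smooth points of `H`).
* [Hartshorne1977] R. Hartshorne, Algebraic Geometry, I Thm. 5.3 (the singular locus of a variety is a proper
  closed subset), I Ex. 1.1.3 / Hilbert's Nullstellensatz I Thm. 1.3A.
-/

noncomputable section

namespace Literature.AlgebraicGeometry.FundamentalGroup

open MvPolynomial

/-! ### An irreducible polynomial over `ℂ` has a smooth zero -/

section SmoothPoint

variable {ι : Type}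

/-- A polynomial over `ℂ` all of whose partial derivatives vanish is constant: a non-zero exponent `m` of
the support has some `m_k ≠ 0`, and then the coefficient of `x^{m − e_k}` in `∂_k g` is `m_k · coeff_m g ≠ 0`
(characteristic zero). [cite: Hartshorne1977, I Thm. 5.3 (proof, characteristic 0)] -/
theorem totalDegree_eq_zero_of_forall_pderiv_eq_zero {g : MvPolynomial ι ℂ}
    (h : ∀ k : ι, pderiv k g = 0) : g.totalDegree = 0 := by
  classical
  rw [totalDegree_eq_zero_iff]
  intro m hm k
  by_contra hk
  have hle : Finsupp.single k 1 ≤ m := by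
    rw [Finsupp.single_le_iff]
    exact Nat.one_le_iff_ne_zero.mpr hk
  have hcoeff := coeff_pderiv (i := k) g (m - Finsupp.single k 1)
  rw [h k, coeff_zero, tsub_add_cancel_of_le hle] at hcoeff
  have hm' : coeff m g ≠ 0 := mem_support_iff.mp hm
  set m' : ι →₀ ℕ := m - Finsupp.single k 1 with hm'def
  have hne : (((m' k : ℕ) : ℂ) + 1) ≠ 0 := by
    exact_mod_cast Nat.succ_ne_zero (m' k)
  exact mul_ne_zero hm' hne hcoeff.symm

/-- An irreducible polynomial over `ℂ` has a non-zero partial derivative (it is not a constant: non-zero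
constants are units). [cite: Hartshorne1977, I Thm. 5.3 (proof, characteristic 0)] -/
theorem exists_pderiv_ne_zero_of_irreducible {g : MvPolynomial ι ℂ} (hg : Irreducible g) :
    ∃ k : ι, pderiv k g ≠ 0 := by
  by_contra hall
  push Not at hall
  have h0 := totalDegree_eq_zero_of_forall_pderiv_eq_zero hall
  rw [totalDegree_eq_zero_iff_eq_C] at h0
  have hc : coeff 0 g ≠ 0 := by
    intro hc
    rw [hc, C_0] at h0
    exact hg.ne_zero h0
  exact hg.not_isUnit (h0 ▸ (isUnit_iff_ne_zero.mpr hc).map C)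

/-- `g` does not divide a non-zero `∂g/∂x_k`: the `x_k`-degree drops by one (`ℂ[x_i]` is a domain, so
degrees add under multiplication). [cite: Hartshorne1977, I Thm. 5.3 (proof)] -/
theorem not_dvd_pderiv_of_ne_zero {g : MvPolynomial ι ℂ} (k : ι) (hD : pderiv k g ≠ 0) :
    ¬ g ∣ pderiv k g := by
  classical
  rintro ⟨q, hq⟩
  have hg0 : g ≠ 0 := by
    rintro rfl
    rw [zero_mul] at hq
    exact hD hq
  have hq0 : q ≠ 0 := by
    rintro rfl
    rw [mul_zero] at hq
    exact hD hq
  -- `deg_k (∂_k g) < deg_k g`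
  have hpos : 0 < degreeOf k g := by
    obtain ⟨m, hm⟩ := Finset.nonempty_iff_ne_empty.mpr (support_eq_empty.not.mpr hD)
    have hcoeff : coeff (m + Finsupp.single k 1) g ≠ 0 := by
      have h := coeff_pderiv (i := k) g m
      intro h0
      rw [h0, zero_mul] at h
      exact (mem_support_iff.mp hm) h
    have hle := monomial_le_degreeOf k (mem_support_iff.mpr hcoeff)
    simp only [Finsupp.coe_add, Pi.add_apply, Finsupp.single_eq_same] at hle
    omega
  have hlt : degreeOf k (pderiv k g) < degreeOf k g := by
    rw [degreeOf_lt_iff hpos]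
    intro m hm
    have hcoeff : coeff (m + Finsupp.single k 1) g ≠ 0 := by
      have h := coeff_pderiv (i := k) g m
      intro h0
      rw [h0, zero_mul] at h
      exact (mem_support_iff.mp hm) h
    have hle := monomial_le_degreeOf k (mem_support_iff.mpr hcoeff)
    simp only [Finsupp.coe_add, Pi.add_apply, Finsupp.single_eq_same] at hle
    omega
  -- but `deg_k (g q) = deg_k g + deg_k q ≥ deg_k g`
  rw [hq, degreeOf_mul_eq hg0 hq0] at hlt
  omega

/-- **An irreducible polynomial `g` over `ℂ` in finitely many variables has a zero at which some partial
derivative does not vanish** — a smooth point of the hypersurface `V(g)` ("le lieu lisse" of an irreducible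
hypersurface is non-empty). Proof: otherwise every `∂_k g` vanishes on `V(g)`, so lies in `I(V(g)) = (g)`
(Nullstellensatz; `(g)` is prime), i.e. `g ∣ ∂_k g` for all `k`; but some `∂_k g ≠ 0` has smaller
`x_k`-degree than `g`. [cite: Deligne1974, proof of Thm. (5.4), p. 291] [cite: Hartshorne1977, I Thm. 5.3] -/
theorem exists_eval_eq_zero_and_eval_pderiv_ne_zero_of_irreducible [Finite ι] {g : MvPolynomial ι ℂ}
    (hg : Irreducible g) : ∃ z : ι → ℂ, eval z g = 0 ∧ ∃ k, eval z (pderiv k g) ≠ 0 := by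
  obtain ⟨k, hk⟩ := exists_pderiv_ne_zero_of_irreducible hg
  by_contra hall
  push Not at hall
  -- `∂_k g` vanishes on `V(g)`, hence lies in `(g)` by the Nullstellensatz
  haveI hprime : (Ideal.span ({g} : Set (MvPolynomial ι ℂ))).IsPrime :=
    (Ideal.span_singleton_prime hg.ne_zero).mpr hg.prime
  have hmem : pderiv k g ∈ vanishingIdeal ℂ (zeroLocus ℂ (Ideal.span ({g} : Set (MvPolynomial ι ℂ)))) := by
    rw [mem_vanishingIdeal_iff]
    intro z hz
    rw [mem_zeroLocus_iff] at hz
    have hzg : eval z g = 0 := by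
      have := hz g (Ideal.subset_span rfl)
      exact this
    exact hall z hzg k
  rw [MvPolynomial.IsPrime.vanishingIdeal_zeroLocus, Ideal.mem_span_singleton] at hmem
  exact not_dvd_pderiv_of_ne_zero k hk hmem

end SmoothPoint

/-! ### Meridians of an irreducible hypersurface exist -/

section Meridian

variable {ι : Type} [Fintype ι]

/-- **The good locus of an irreducible hypersurface `V(g)` (one listed component) is non-empty**: a smooth
point of `V(g)`. [cite: Deligne1974, proof of Thm. (5.4), p. 291] -/
theorem goodLocus_nonempty_of_irreducible {g : MvPolynomial ι ℂ} (hg : Irreducible g) :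
    (MeridianConj.goodLocus ![g] 0).Nonempty := by
  obtain ⟨z, hz, k, hk⟩ := exists_eval_eq_zero_and_eval_pderiv_ne_zero_of_irreducible hg
  refine ⟨z, ?_, fun i hi => absurd (Subsingleton.elim i 0) hi, k, ?_⟩
  · simpa using hz
  · simpa using hk

/-- **An irreducible affine hypersurface has a meridian based at every point of its complement**: pick a
smooth point of `V(g)` (`goodLocus_nonempty_of_irreducible`), a transversal coordinate disc there and a leash
in the path-connected complement (`MeridianConj.exists_meridian_of_mem_goodLocus`). This is the meridian
from which, by Zariski–van Kampen, `π₁(ℂ^ι ∖ V(g))` is normally generated.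
[cite: Deligne1974, (5.2) and proof of Thm. (5.4), pp. 290–291] [cite: Shimada2010ZvK, §3 Prop. 3.4] -/
theorem nonempty_meridian_of_irreducible {g : MvPolynomial ι ℂ} (hg : Irreducible g)
    (s : affineHypersurfaceComplement ![g]) : Nonempty (Meridian ![g] s 0) := by
  obtain ⟨z, hz⟩ := goodLocus_nonempty_of_irreducible hg
  have hU : IsPathConnected (affineHypersurfaceComplement ![g]) :=
    MeridianConj.isPathConnected_affineHypersurfaceComplement fun j => by
      fin_cases j
      exact hg.ne_zero
  obtain ⟨μ, -⟩ := MeridianConj.exists_meridian_of_mem_goodLocus hU s hz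
  exact ⟨μ⟩

end Meridian

end Literature.AlgebraicGeometry.FundamentalGroup

end
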